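import Summits.CriticalPhenomena.PercolationContinuityZ3.Theorems.Transplant.SkelPhiRouteDatum
import Summits.CriticalPhenomena.PercolationContinuityZ3.Theorems.Transplant.SkelPhiKitsHab
import HarnessLib

/-!
# D″ node, LEVEL 1 (c)/(c′) v2.1 "TYPED ROUTE CENTRES" (p3-g7 2026-08-21T05:43:08Z): the ROUTE DATUM with the route launched from a TYPED
# centre `c'` near the kit centre `c` — the route family `Dr` (ONE monotone band, certified at the root's type and transported to `c'` by `c`'s
# frame) sizes the route rectangle at `c'`, its seed `Dr.Λ c' Dr.k` is nested in the kit seed `D.Λ c D.k`, and the kit data `D` (sup-band over the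
# types) serves the zone and the kit link exactly as landed. The typed centre enters through ONE per-centre hypothesis `hctr` (discharged by
# p3-g7's `exists_typedCtr` + `real_event_frame` + `fatSeqOff_subset_fatSeqOff_of_near`, addendum N). One theorem for every exploration graph
# `Γ ≤ G` (`routeDatumT`); the per-contact dichotomies of `kitClause'` (`kitCon_stepIT`, `Γ = winGraph G w₀ R`) and of `kitClauseHab'`
# (`kitCon_stepIHabT`, `Γ = winGraphIn G Ω`) follow — conclusions UNCHANGED, so the kit layer consumes `D` as landed.

builds on p205010 (kernel theorem, internal audit signed; external expert review pending) — nothing in this file uses p205010.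
Lane `prim-bschramm`, seat `prim-bschramm-p1` (gen 9); helper file (`--supports stmt-CriticalPhenomena-4575 --as helper`).
* **`routeDatumT`**, **`kitCon_stepIT`**, **`kitCon_stepIHabT`**.
[cite: KozmaNitzan2024, §4 Lemma 10 Step IV (pp. 20–21), p. 20 ((22)–(23): lattice symmetries place the local objects), Lemma 11 (pp. 22–23)]
-/

noncomputable section

open scoped Classical

namespace Summit.CriticalPhenomena.PercolationContinuityZ3.Theorems.Transplant

namespace Skelφ

open MeasureTheory
open Literature.Probability.Percolation Literature.Probability.LatticeModels SimpleGraph KNLevels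
open Literature.Barriers.CriticalPhenomena (graphBall graphBall_finite mem_graphBall_self graphBall_mono)
open Skel (winGraph winGraph_adj winGraph_le KitGeom winGraphIn winGraphIn_adj winGraphIn_le)
open SkelI (tanOff)
open Literature.Probability.Percolation.KozmaNitzan.Cells (oth oth_ne eq_oth_of_ne oth_oth)

variable {V : Type} [DecidableEq V] {G : SimpleGraph V} [G.LocallyFinite] {φ : V → Site 2} {types : Finset V}

/-! ## The route datum from a typed route centre -/

section Datum

variable {w₀ : V} {R : ℕ} {lo hi : Site 2} {j ℓs M K r₀ : ℕ} {A : Fin 2 → Fin 2 → ℕ} {Rk : Fin 2 → ℕ}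

/-- **THE ROUTE DATUM OF A NEAR CONTACT FROM A TYPED ROUTE CENTRE** (D″ v2.1 "typed route centres", p3-g7 2026-08-21T05:43:08Z): as
`Skelφ.routeDatumS`, but the ROUTE is launched from a centre `c'` near the kit centre `c` (`c' ∈ B_G(c, dG)`, planar offset `≤ D₀`) at which the
route family `Dr` (one monotone band) is certified along `ax` for every extent in `[ℓ₀, ℓ₁]`, with the route seed nested in the kit seed
(`Dr.Λ c' Dr.k ⊆ D.Λ c D.k`, so the link starts from the kit seed by monotonicity); the kit data `D` serves the zone and the kit link unchanged;
the room is read at the walker `φ c'` of the `(j + D₀)`-level box. Stated once for any exploration graph `Γ ≤ G` carrying the subbox weighting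
(`winGraph G w₀ R`: `kitCon_stepIT`; `winGraphIn G Ω`: `kitCon_stepIHabT`). Under the Step-I′ certificate at the
running density `q` (threshold `1 − δ₂`; data `D` over the shifted fat prisms `D.Λ = fatSeqOff off`), a kit with zone scale `Mz ∈ Sz`, extents
`ℓK I` certified along each axis, half-widths `A I = widths (ℓK I)` and radii `Rk I = D.R (amax (A I))` fitting the slab room, and a ROUTE
along the axis `ax` with sign `sg₀`: extents `ℓ ∈ [ℓ₀, ℓ₁]` certified along `ax`, beyond the zone scale (`Mz + 1 ≤ ℓ₀`) and within depth `r₀`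
of the inner neighbour, and a planar room at every point of the level box (band rectangle in `Preg`, a half of its `sg₀`-side in `Pcore`) —
for every NEAR contact `x` of the window level, at the kit centre `c = rectCtr …` behind the deep slab: (i) the zone of `D.Λ c` between `D.k`
and `Mz`, (ii) the link from the seed `D.Λ c D.k` to the near side inside the kit rectangle, each with `P_q`-probability `> 1 − δ₂`, and
(iii) route sets `Qt = ` the fat band rectangle at `c`, `Ft = ` the certified half of its far side, with `Ft ⊆ T` (`T ⊇` the window over
`Pcore`), `Qt ⊆ D` (`D ⊇` the window over `Preg`), `Ft` off the zone box `D.Λ c Mz`, and `P_{Wt}(D.Λ c D.k ↔ Ft inside Qt) > 1 − δ₂` under any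
subbox weighting `Wt` of the window graph on `D`. [cite: KozmaNitzan2024, §4 Lemma 10 Step IV (pp. 20–21), Lemma 11 (pp. 22–23)] -/
theorem routeDatumT [Countable V] (hlip : Lip G φ) (hstep : Steps G φ) (hfr : Frames G φ types) {p : unitInterval}
    (hC : CylSubcritical G φ types p) {D : StepI.Data V} {off : ℕ} (hD : D.Λ = fatSeqOff hfr hC off)
    {Sz Sx Sy : Finset ℕ} {q : unitInterval} {δ₂ : ℝ}
    (h : ∀ i ∈ StepI.index types Sz Sx Sy, 1 - δ₂ < (bondPercolation G q).real (StepI.event G φ D i))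
    -- the kit: zone scale, certified extents, half-widths, radii
    {Mz : ℕ} (hMz : Mz ∈ Sz) {ℓK : Fin 2 → ℕ} (hℓK0 : ∀ I, I = 0 → ℓK I ∈ Sx) (hℓK1 : ∀ I, I = 1 → ℓK I ∈ Sy)
    (hAw : ∀ I, A I = StepI.widths D.Gb D.Fb I (ℓK I)) (hRk : ∀ I, Rk I = D.R (amax (A I)))
    -- the slab room of the kit rectangle
    (hwide : ∀ i, (lo - (j : Site 2)) i + 2 * tanOff ℓs M ≤ (hi + (j : Site 2)) i) (hA : ∀ i k, A i k ≤ M)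
    (hK : ∀ i, ℓs + 1 + A i i + Rk i ≤ K) (hr₀ : ℓs + 1 + tanOff ℓs M + K ≤ r₀) (hR : r₀ ≤ R)
    -- the route: data `Dr`, axis, extents `[ℓ₀, ℓ₁]` certified at a TYPED CENTRE `c'` near every vertex `c` (graph distance `≤ dG`, planar
    -- offset `≤ D₀`, route seed nested in the kit seed), beyond the zone scale, depth
    (Dr : StepI.Data V) (ax : Fin 2) {ℓ₀ ℓ₁ dG D₀ : ℕ} (hMℓ : Mz + D₀ + 1 ≤ ℓ₀)
    (hctr : ∀ c : V, ∃ c' : V, c' ∈ graphBall G c dG ∧ (∀ i, |φ c' i - φ c i| ≤ D₀) ∧ Dr.Λ c' Dr.k ⊆ D.Λ c D.k ∧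
      ∀ ℓ, ℓ₀ ≤ ℓ → ℓ ≤ ℓ₁ → ∀ σ τ : ℤˣ, 1 - δ₂ < (bondPercolation G q).real (StepI.event G φ Dr (c', ℓ, some (ax, σ, τ))))
    (hdepth : ∀ I ℓ, ℓ₀ ≤ ℓ → ℓ ≤ ℓ₁ → 2 * ℓs + 2 + tanOff ℓs M + A I I + dG + Dr.R (amax (StepI.widths Dr.Gb Dr.Fb ax ℓ)) ≤ r₀)
    -- the band spread of the room dominates the certified transverse half-width
    {Wr : ℕ → ℕ} (hWr : ∀ ℓ, ℓ₀ ≤ ℓ → ℓ ≤ ℓ₁ → StepI.widths Dr.Gb Dr.Fb ax ℓ (oth ax) ≤ Wr ℓ)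
    -- the planar room at every point of the level box
    {Preg Pcore : Finset (Site 2)}
    (hroom : ∀ v ∈ Finset.Icc (lo - ((j + D₀ : ℕ) : Site 2)) (hi + ((j + D₀ : ℕ) : Site 2)), ∃ ℓ : ℕ, ℓ₀ ≤ ℓ ∧ ℓ ≤ ℓ₁ ∧
      ∃ σ : ℤ, (σ = 1 ∨ σ = -1) ∧
        (∀ y : Site 2, |y ax - v ax| ≤ ℓ → |y (oth ax) - v (oth ax)| ≤ Wr ℓ → y ∈ Preg) ∧
        ∃ τ : ℤ, (τ = 1 ∨ τ = -1) ∧ ∀ y : Site 2, y ax - v ax = σ * ℓ → 0 ≤ τ * (y (oth ax) - v (oth ax)) →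
          |y (oth ax) - v (oth ax)| ≤ Wr ℓ → y ∈ Pcore)
    -- the exploration graph `Γ ≤ G`, the windows over the room inside the region / the target with their `G`-edges in `Γ`, the subbox
    -- weighting of `Γ` on the region
    {Γ : SimpleGraph V} [Γ.LocallyFinite] (hΓ : Γ ≤ G) {Dg T : Finset V} (hPD : Win G φ w₀ Preg R ⊆ Dg) (hPT : Win G φ w₀ Pcore R ⊆ T)
    (hadj : ∀ u ∈ Win G φ w₀ Preg R, ∀ v ∈ Win G φ w₀ Preg R, G.Adj u v → Γ.Adj u v)
    {Wt : Sym2 V → unitInterval} (hWD : IsSubbox Γ Wt q Dg)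
    -- the near contact
    {x : V} (hx : x ∈ outerBoundary (winGraph G w₀ R) (winLevel G φ w₀ R lo hi j))
    (hnear : inNbr G φ w₀ R (Finset.Icc (lo - (j : Site 2)) (hi + (j : Site 2))) x ∈ graphBall G w₀ (R - r₀)) :
    1 - δ₂ < (bondPercolation G q).real (UniqZone.zone G
        (D.Λ (rectCtr hstep (deepCtr G φ w₀ R (lo - (j : Site 2)) (hi + (j : Site 2)) ℓs M x)
          (exitDir G φ w₀ R (lo - (j : Site 2)) (hi + (j : Site 2)) x).1 (exitDir G φ w₀ R (lo - (j : Site 2)) (hi + (j : Site 2)) x).2 ℓs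
          (A (exitDir G φ w₀ R (lo - (j : Site 2)) (hi + (j : Site 2)) x).1))) D.k Mz) ∧
    1 - δ₂ < (bondPercolation G q).real (linkIn
        (rectPrism G φ (rectCtr hstep (deepCtr G φ w₀ R (lo - (j : Site 2)) (hi + (j : Site 2)) ℓs M x)
          (exitDir G φ w₀ R (lo - (j : Site 2)) (hi + (j : Site 2)) x).1 (exitDir G φ w₀ R (lo - (j : Site 2)) (hi + (j : Site 2)) x).2 ℓs
          (A (exitDir G φ w₀ R (lo - (j : Site 2)) (hi + (j : Site 2)) x).1))
          (A (exitDir G φ w₀ R (lo - (j : Site 2)) (hi + (j : Site 2)) x).1) (Rk (exitDir G φ w₀ R (lo - (j : Site 2)) (hi + (j : Site 2)) x).1))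
        (D.Λ (rectCtr hstep (deepCtr G φ w₀ R (lo - (j : Site 2)) (hi + (j : Site 2)) ℓs M x)
          (exitDir G φ w₀ R (lo - (j : Site 2)) (hi + (j : Site 2)) x).1 (exitDir G φ w₀ R (lo - (j : Site 2)) (hi + (j : Site 2)) x).2 ℓs
          (A (exitDir G φ w₀ R (lo - (j : Site 2)) (hi + (j : Site 2)) x).1)) D.k)
        (rectU hstep w₀ R lo hi j ℓs M A Rk x)) ∧
    ∃ Qt Ft : Finset V, Ft ⊆ T ∧ Qt ⊆ Dg ∧
      Disjoint Ft (D.Λ (rectCtr hstep (deepCtr G φ w₀ R (lo - (j : Site 2)) (hi + (j : Site 2)) ℓs M x)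
        (exitDir G φ w₀ R (lo - (j : Site 2)) (hi + (j : Site 2)) x).1 (exitDir G φ w₀ R (lo - (j : Site 2)) (hi + (j : Site 2)) x).2 ℓs
        (A (exitDir G φ w₀ R (lo - (j : Site 2)) (hi + (j : Site 2)) x).1)) Mz) ∧
      1 - δ₂ < (prodBernoulli Wt).real (linkIn (↑Qt)
        (D.Λ (rectCtr hstep (deepCtr G φ w₀ R (lo - (j : Site 2)) (hi + (j : Site 2)) ℓs M x)
          (exitDir G φ w₀ R (lo - (j : Site 2)) (hi + (j : Site 2)) x).1 (exitDir G φ w₀ R (lo - (j : Site 2)) (hi + (j : Site 2)) x).2 ℓs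
          (A (exitDir G φ w₀ R (lo - (j : Site 2)) (hi + (j : Site 2)) x).1)) D.k) Ft) := by
  -- the geometry of the near contact: inner neighbour `y`, deep centre `t`, kit centre `c`
  have hx' : x ∈ outerBoundary (winGraph G w₀ R) (Win G φ w₀ (Finset.Icc (lo - (j : Site 2)) (hi + (j : Site 2))) R) := hx
  obtain ⟨-, -, hyP⟩ := inNbr_spec hx'
  have hty := (deepCtr_spec hstep (ℓs := ℓs) (M := M) hwide hyP).1
  have htw := BoxProdZ2.mem_graphBall_add G hnear hty
  have hrectS := rectPrism_subset_shellWin hlip hstep hwide hA hK hr₀ hR hx hnear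
  have hrectU : rectU hstep w₀ R lo hi j ℓs M A Rk x =
      nearSide G hstep (deepCtr G φ w₀ R (lo - (j : Site 2)) (hi + (j : Site 2)) ℓs M x)
        (exitDir G φ w₀ R (lo - (j : Site 2)) (hi + (j : Site 2)) x).1 (exitDir G φ w₀ R (lo - (j : Site 2)) (hi + (j : Site 2)) x).2 ℓs
        (A (exitDir G φ w₀ R (lo - (j : Site 2)) (hi + (j : Site 2)) x).1) (Rk (exitDir G φ w₀ R (lo - (j : Site 2)) (hi + (j : Site 2)) x).1) :=
    rfl
  rw [hrectU]
  generalize (exitDir G φ w₀ R (lo - (j : Site 2)) (hi + (j : Site 2)) x).1 = I at hrectS ⊢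
  generalize (exitDir G φ w₀ R (lo - (j : Site 2)) (hi + (j : Site 2)) x).2 = sg at hrectS ⊢
  generalize deepCtr G φ w₀ R (lo - (j : Site 2)) (hi + (j : Site 2)) ℓs M x = t at hrectS htw ⊢
  set c : V := rectCtr hstep t I sg ℓs (A I) with hc
  have hcw : c ∈ graphBall G w₀ (R - r₀ + (ℓs + 1 + tanOff ℓs M) + (ℓs + 1 + A I I)) :=
    BoxProdZ2.mem_graphBall_add G htw (rectCtr_mem_graphBall hstep t I sg ℓs (A I))
  have hcP : φ c ∈ Finset.Icc (lo - (j : Site 2)) (hi + (j : Site 2)) :=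
    SkelI.mem_Icc_of_mem_shell ((mem_Win G φ).1 (hrectS ((mem_rectPrismFin G φ).2 (self_mem_rectPrism G φ c (A I) (Rk I))))).2
  refine ⟨zone_at_center hfr hC hD h c hMz, ?_, ?_⟩
  · -- (ii) the kit link at `c`: the certified half lies in the near side
    have hl := link_at_center hfr hC hD h c I (hℓK0 I) (hℓK1 I) sg 1
    rw [← hAw I, ← hRk I] at hl
    exact hl.trans_le (StepI.real_linkIn_rside_ge_rhalf q c (A I) (Rk I) (D.Λ c D.k) I (sg : ℤ) ((1 : ℤˣ) : ℤ))
  · -- (iii) the route from the typed centre `c'` near `c`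
    obtain ⟨c', hc'B, hc'off, hnest, hevr⟩ := hctr c
    have hc'P : φ c' ∈ Finset.Icc (lo - ((j + D₀ : ℕ) : Site 2)) (hi + ((j + D₀ : ℕ) : Site 2)) := by
      rw [Finset.mem_Icc] at hcP ⊢
      obtain ⟨h1, h2⟩ := hcP
      constructor <;> intro i <;> have h1i := h1 i <;> have h2i := h2 i <;> have hdi := abs_le.1 (hc'off i) <;>
        simp only [Pi.sub_apply, Pi.add_apply, Pi.natCast_apply, Nat.cast_add] at h1i h2i ⊢ <;> linarith [hdi.1, hdi.2]
    obtain ⟨ℓ, hℓ0, hℓ1, sg₀, hsg₀, hrect, τ, hτ, hhalf⟩ := hroom (φ c') hc'P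
    have hWℓ : ((StepI.widths Dr.Gb Dr.Fb ax ℓ (oth ax) : ℕ) : ℤ) ≤ Wr ℓ := by exact_mod_cast hWr ℓ hℓ0 hℓ1
    obtain ⟨σu, hσu⟩ : ∃ u : ℤˣ, (u : ℤ) = sg₀ := by
      rcases hsg₀ with h0 | h0
      · exact ⟨1, by rw [h0, Units.val_one]⟩
      · exact ⟨-1, by rw [h0, Units.val_neg, Units.val_one]⟩
    obtain ⟨τu, hτu⟩ : ∃ u : ℤˣ, (u : ℤ) = τ := by
      rcases hτ with h0 | h0
      · exact ⟨1, by rw [h0, Units.val_one]⟩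
      · exact ⟨-1, by rw [h0, Units.val_neg, Units.val_one]⟩
    have hev := hevr ℓ hℓ0 hℓ1 σu τu
    rw [StepI.event_some, hσu, hτu] at hev
    have hdep := hdepth I ℓ hℓ0 hℓ1
    set a : Fin 2 → ℕ := StepI.widths Dr.Gb Dr.Fb ax ℓ with ha
    set Rt : ℕ := Dr.R (amax a) with hRt
    have haax : a ax = ℓ := by rw [ha, StepI.widths_self]
    -- depth: the fat band rectangle at `c'` lies in the window ball
    have hc'w := BoxProdZ2.mem_graphBall_add G hcw hc'B
    have hQB : ∀ w ∈ rectPrism G φ c' a Rt, w ∈ graphBall G w₀ R := fun w hw =>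
      graphBall_mono G w₀ (by omega) (BoxProdZ2.mem_graphBall_add G hc'w (rectPrism_subset_graphBall G φ c' a Rt hw))
    -- planar room: the fat band rectangle lies in the window over `Preg`
    have hQW : rectPrismFin G φ c' a Rt ⊆ Win G φ w₀ Preg R := fun w hw => by
      have hwQ := (mem_rectPrismFin G φ).1 hw
      have h1 := abs_sub_le_of_mem_rectPrism hwQ ax
      rw [haax] at h1
      exact (mem_Win G φ).2 ⟨hQB w hwQ, hrect (φ w) h1 ((abs_sub_le_of_mem_rectPrism hwQ (oth ax)).trans hWℓ)⟩
    have hQD : rectPrismFin G φ c' a Rt ⊆ Dg := hQW.trans hPD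
    refine ⟨rectPrismFin G φ c' a Rt, rhalf G φ c' a Rt ax sg₀ τ, fun w hw => ?_, hQD, ?_, ?_⟩
    · -- `Ft ⊆ T`: the certified half lies in the window over `Pcore`
      obtain ⟨hwQ, h1, h2⟩ := (mem_rhalf G φ).1 hw
      rw [haax] at h1
      exact hPT ((mem_Win G φ).2 ⟨hQB w hwQ, hhalf (φ w) h1 h2 ((abs_sub_le_of_mem_rectPrism hwQ (oth ax)).trans hWℓ)⟩)
    · -- `Ft` is off the kit's zone box: its `ax`-coordinate is `≥ ℓ - D₀ > Mz` away from `φ c`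
      rw [hD]
      refine Finset.disjoint_left.2 fun w hw hz => ?_
      obtain ⟨-, h1, -⟩ := (mem_rhalf G φ).1 hw
      rw [haax] at h1
      have hzc := fatSeqOff_subset_cyl hfr hC off c Mz (Finset.mem_coe.2 hz)
      rw [mem_cyl, mem_box] at hzc
      have h3 := hzc ax
      simp only [Pi.sub_apply] at h3
      have hd := abs_le.1 (hc'off ax)
      have hℓM : (Mz : ℤ) + D₀ + 1 ≤ ℓ := by exact_mod_cast hMℓ.trans hℓ0
      rcases hsg₀ with h0 | h0 <;> rw [h0] at h1 <;> linarith [h3.1, h3.2, hd.1, hd.2]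
    · -- the route link from the nested route seed, transferred to the subbox weighting of `Γ`
      have heq := Skel.real_eq_of_isSubbox_of_le hΓ hWD hQD (fun u hu v hv huv => hadj u (hQW hu) v (hQW hv) huv)
        (determinedBy_linkIn (↑(rectPrismFin G φ c' a Rt)) (D.Λ c D.k) (rhalf G φ c' a Rt ax sg₀ τ) subset_rfl)
        (measurableSet_linkIn _ _ _)
      rw [heq, coe_rectPrismFin]
      exact hev.trans_le (measureReal_mono (linkIn_mono subset_rfl hnest subset_rfl) (measure_ne_top _ _))

/-- **THE PER-CONTACT DICHOTOMY `hcon'` OF `kitClause'`, DISCHARGED, TYPED ROUTE CENTRES** (`routeDatumT` at `Γ = winGraph G w₀ R` + far contacts): a FAR contact (inner neighbour off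
`B_G(w₀, R − r₀)`) is served by its inner neighbour, required to lie in the target (the rim part of the enlarged target); a NEAR contact by
`routeDatum`. The conclusion is literally the hypothesis `hcon'` of `Skelφ.kitClause'` with `Λc := D.Λ`, `kz := D.k`, `n := Mz`.
[cite: KozmaNitzan2024, §4 Lemma 10 Step IV (pp. 20–21), Lemma 11 (pp. 22–23)] -/
theorem kitCon_stepIT [Countable V] (hlip : Lip G φ) (hstep : Steps G φ) (hfr : Frames G φ types) {p : unitInterval}
    (hC : CylSubcritical G φ types p) {D : StepI.Data V} {off : ℕ} (hD : D.Λ = fatSeqOff hfr hC off)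
    {Sz Sx Sy : Finset ℕ} {q : unitInterval} {δ₂ : ℝ}
    (h : ∀ i ∈ StepI.index types Sz Sx Sy, 1 - δ₂ < (bondPercolation G q).real (StepI.event G φ D i))
    {Mz : ℕ} (hMz : Mz ∈ Sz) {ℓK : Fin 2 → ℕ} (hℓK0 : ∀ I, I = 0 → ℓK I ∈ Sx) (hℓK1 : ∀ I, I = 1 → ℓK I ∈ Sy)
    (hAw : ∀ I, A I = StepI.widths D.Gb D.Fb I (ℓK I)) (hRk : ∀ I, Rk I = D.R (amax (A I)))
    (hwide : ∀ i, (lo - (j : Site 2)) i + 2 * tanOff ℓs M ≤ (hi + (j : Site 2)) i) (hA : ∀ i k, A i k ≤ M)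
    (hK : ∀ i, ℓs + 1 + A i i + Rk i ≤ K) (hr₀ : ℓs + 1 + tanOff ℓs M + K ≤ r₀) (hR : r₀ ≤ R)
    (Dr : StepI.Data V) (ax : Fin 2) {ℓ₀ ℓ₁ dG D₀ : ℕ} (hMℓ : Mz + D₀ + 1 ≤ ℓ₀)
    (hctr : ∀ c : V, ∃ c' : V, c' ∈ graphBall G c dG ∧ (∀ i, |φ c' i - φ c i| ≤ D₀) ∧ Dr.Λ c' Dr.k ⊆ D.Λ c D.k ∧
      ∀ ℓ, ℓ₀ ≤ ℓ → ℓ ≤ ℓ₁ → ∀ σ τ : ℤˣ, 1 - δ₂ < (bondPercolation G q).real (StepI.event G φ Dr (c', ℓ, some (ax, σ, τ))))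
    (hdepth : ∀ I ℓ, ℓ₀ ≤ ℓ → ℓ ≤ ℓ₁ → 2 * ℓs + 2 + tanOff ℓs M + A I I + dG + Dr.R (amax (StepI.widths Dr.Gb Dr.Fb ax ℓ)) ≤ r₀)
    -- the band spread of the room dominates the certified transverse half-width
    {Wr : ℕ → ℕ} (hWr : ∀ ℓ, ℓ₀ ≤ ℓ → ℓ ≤ ℓ₁ → StepI.widths Dr.Gb Dr.Fb ax ℓ (oth ax) ≤ Wr ℓ)
    {Preg Pcore : Finset (Site 2)}
    (hroom : ∀ v ∈ Finset.Icc (lo - ((j + D₀ : ℕ) : Site 2)) (hi + ((j + D₀ : ℕ) : Site 2)), ∃ ℓ : ℕ, ℓ₀ ≤ ℓ ∧ ℓ ≤ ℓ₁ ∧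
      ∃ σ : ℤ, (σ = 1 ∨ σ = -1) ∧
        (∀ y : Site 2, |y ax - v ax| ≤ ℓ → |y (oth ax) - v (oth ax)| ≤ Wr ℓ → y ∈ Preg) ∧
        ∃ τ : ℤ, (τ = 1 ∨ τ = -1) ∧ ∀ y : Site 2, y ax - v ax = σ * ℓ → 0 ≤ τ * (y (oth ax) - v (oth ax)) →
          |y (oth ax) - v (oth ax)| ≤ Wr ℓ → y ∈ Pcore)
    {Dg T : Finset V} (hPD : Win G φ w₀ Preg R ⊆ Dg) (hPT : Win G φ w₀ Pcore R ⊆ T)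
    {Wt : Sym2 V → unitInterval} (hWD : IsSubbox (winGraph G w₀ R) Wt q Dg)
    -- far contacts: the inner neighbour lies in the target
    (hfarT : ∀ x ∈ outerBoundary (winGraph G w₀ R) (winLevel G φ w₀ R lo hi j),
      inNbr G φ w₀ R (Finset.Icc (lo - (j : Site 2)) (hi + (j : Site 2))) x ∉ graphBall G w₀ (R - r₀) →
      inNbr G φ w₀ R (Finset.Icc (lo - (j : Site 2)) (hi + (j : Site 2))) x ∈ T) (R' : ℕ) :
    ∀ x ∈ outerBoundary (winGraph G w₀ R) (winLevel G φ w₀ R lo hi j),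
      (∃ u ∈ (slabGeomDeep G φ w₀ R lo hi j ℓs M R' r₀ (rectU hstep w₀ R lo hi j ℓs M A Rk)).U x, u ∈ T) ∨
      (inNbr G φ w₀ R (Finset.Icc (lo - (j : Site 2)) (hi + (j : Site 2))) x ∈ graphBall G w₀ (R - r₀) ∧
        1 - δ₂ < (bondPercolation G q).real (UniqZone.zone G
          (D.Λ (rectCtr hstep (deepCtr G φ w₀ R (lo - (j : Site 2)) (hi + (j : Site 2)) ℓs M x)
            (exitDir G φ w₀ R (lo - (j : Site 2)) (hi + (j : Site 2)) x).1 (exitDir G φ w₀ R (lo - (j : Site 2)) (hi + (j : Site 2)) x).2 ℓs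
            (A (exitDir G φ w₀ R (lo - (j : Site 2)) (hi + (j : Site 2)) x).1))) D.k Mz) ∧
        1 - δ₂ < (bondPercolation G q).real (linkIn
          (rectPrism G φ (rectCtr hstep (deepCtr G φ w₀ R (lo - (j : Site 2)) (hi + (j : Site 2)) ℓs M x)
            (exitDir G φ w₀ R (lo - (j : Site 2)) (hi + (j : Site 2)) x).1 (exitDir G φ w₀ R (lo - (j : Site 2)) (hi + (j : Site 2)) x).2 ℓs
            (A (exitDir G φ w₀ R (lo - (j : Site 2)) (hi + (j : Site 2)) x).1))
            (A (exitDir G φ w₀ R (lo - (j : Site 2)) (hi + (j : Site 2)) x).1) (Rk (exitDir G φ w₀ R (lo - (j : Site 2)) (hi + (j : Site 2)) x).1))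
          (D.Λ (rectCtr hstep (deepCtr G φ w₀ R (lo - (j : Site 2)) (hi + (j : Site 2)) ℓs M x)
            (exitDir G φ w₀ R (lo - (j : Site 2)) (hi + (j : Site 2)) x).1 (exitDir G φ w₀ R (lo - (j : Site 2)) (hi + (j : Site 2)) x).2 ℓs
            (A (exitDir G φ w₀ R (lo - (j : Site 2)) (hi + (j : Site 2)) x).1)) D.k)
          (rectU hstep w₀ R lo hi j ℓs M A Rk x)) ∧
        ∃ Qt Ft : Finset V, Ft ⊆ T ∧ Qt ⊆ Dg ∧
          Disjoint Ft (D.Λ (rectCtr hstep (deepCtr G φ w₀ R (lo - (j : Site 2)) (hi + (j : Site 2)) ℓs M x)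
            (exitDir G φ w₀ R (lo - (j : Site 2)) (hi + (j : Site 2)) x).1 (exitDir G φ w₀ R (lo - (j : Site 2)) (hi + (j : Site 2)) x).2 ℓs
            (A (exitDir G φ w₀ R (lo - (j : Site 2)) (hi + (j : Site 2)) x).1)) Mz) ∧
          1 - δ₂ < (prodBernoulli Wt).real (linkIn (↑Qt)
            (D.Λ (rectCtr hstep (deepCtr G φ w₀ R (lo - (j : Site 2)) (hi + (j : Site 2)) ℓs M x)
              (exitDir G φ w₀ R (lo - (j : Site 2)) (hi + (j : Site 2)) x).1 (exitDir G φ w₀ R (lo - (j : Site 2)) (hi + (j : Site 2)) x).2 ℓs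
              (A (exitDir G φ w₀ R (lo - (j : Site 2)) (hi + (j : Site 2)) x).1)) D.k) Ft)) := by
  intro x hx
  by_cases hnear : inNbr G φ w₀ R (Finset.Icc (lo - (j : Site 2)) (hi + (j : Site 2))) x ∈ graphBall G w₀ (R - r₀)
  · exact Or.inr ⟨hnear, routeDatumT hlip hstep hfr hC hD h hMz hℓK0 hℓK1 hAw hRk hwide hA hK hr₀ hR Dr ax hMℓ hctr hdepth hWr
      hroom (winGraph_le G w₀ R) hPD hPT (Skel.adj_winGraph_of_subset_graphBall fun v hv => ((mem_Win G φ).1 hv).1) hWD hx hnear⟩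
  · refine Or.inl ⟨inNbr G φ w₀ R (Finset.Icc (lo - (j : Site 2)) (hi + (j : Site 2))) x, ?_, hfarT x hx hnear⟩
    simp [slabGeomDeep, hnear]

/-- **THE PER-CONTACT DICHOTOMY `hcon'` OF `kitClauseHab'`, DISCHARGED, TYPED ROUTE CENTRES** (`routeDatumT` at `Γ = winGraphIn G Ω` + far remedies): a NON-PLAIN `Ω`-contact is served
by its inner `Ω`-neighbour and a FAR plain contact by its inner neighbour, both required to lie in the target (the rim part of the enlarged
target); a NEAR plain contact by `routeDatumHab`. The conclusion is literally the hypothesis `hcon'` of `Skelφ.kitClauseHab'` with `Λc := D.Λ`,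
`kz := D.k`, `n := Mz`.
[cite: KozmaNitzan2024, §4 Lemma 10 Step IV (pp. 20–21), Lemma 11 (pp. 22–23)] -/
theorem kitCon_stepIHabT [Countable V] (hlip : Lip G φ) (hstep : Steps G φ) (hfr : Frames G φ types) {p : unitInterval}
    (hC : CylSubcritical G φ types p) {D : StepI.Data V} {off : ℕ} (hD : D.Λ = fatSeqOff hfr hC off)
    {Sz Sx Sy : Finset ℕ} {q : unitInterval} {δ₂ : ℝ}
    (h : ∀ i ∈ StepI.index types Sz Sx Sy, 1 - δ₂ < (bondPercolation G q).real (StepI.event G φ D i))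
    {Mz : ℕ} (hMz : Mz ∈ Sz) {ℓK : Fin 2 → ℕ} (hℓK0 : ∀ I, I = 0 → ℓK I ∈ Sx) (hℓK1 : ∀ I, I = 1 → ℓK I ∈ Sy)
    (hAw : ∀ I, A I = StepI.widths D.Gb D.Fb I (ℓK I)) (hRk : ∀ I, Rk I = D.R (amax (A I)))
    (hwide : ∀ i, (lo - (j : Site 2)) i + 2 * tanOff ℓs M ≤ (hi + (j : Site 2)) i) (hA : ∀ i k, A i k ≤ M)
    (hK : ∀ i, ℓs + 1 + A i i + Rk i ≤ K) (hr₀ : ℓs + 1 + tanOff ℓs M + K ≤ r₀) (hR : r₀ ≤ R)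
    (Dr : StepI.Data V) (ax : Fin 2) {ℓ₀ ℓ₁ dG D₀ : ℕ} (hMℓ : Mz + D₀ + 1 ≤ ℓ₀)
    (hctr : ∀ c : V, ∃ c' : V, c' ∈ graphBall G c dG ∧ (∀ i, |φ c' i - φ c i| ≤ D₀) ∧ Dr.Λ c' Dr.k ⊆ D.Λ c D.k ∧
      ∀ ℓ, ℓ₀ ≤ ℓ → ℓ ≤ ℓ₁ → ∀ σ τ : ℤˣ, 1 - δ₂ < (bondPercolation G q).real (StepI.event G φ Dr (c', ℓ, some (ax, σ, τ))))
    (hdepth : ∀ I ℓ, ℓ₀ ≤ ℓ → ℓ ≤ ℓ₁ → 2 * ℓs + 2 + tanOff ℓs M + A I I + dG + Dr.R (amax (StepI.widths Dr.Gb Dr.Fb ax ℓ)) ≤ r₀)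
    -- the band spread of the room dominates the certified transverse half-width
    {Wr : ℕ → ℕ} (hWr : ∀ ℓ, ℓ₀ ≤ ℓ → ℓ ≤ ℓ₁ → StepI.widths Dr.Gb Dr.Fb ax ℓ (oth ax) ≤ Wr ℓ)
    {Preg Pcore : Finset (Site 2)}
    (hroom : ∀ v ∈ Finset.Icc (lo - ((j + D₀ : ℕ) : Site 2)) (hi + ((j + D₀ : ℕ) : Site 2)), ∃ ℓ : ℕ, ℓ₀ ≤ ℓ ∧ ℓ ≤ ℓ₁ ∧
      ∃ σ : ℤ, (σ = 1 ∨ σ = -1) ∧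
        (∀ y : Site 2, |y ax - v ax| ≤ ℓ → |y (oth ax) - v (oth ax)| ≤ Wr ℓ → y ∈ Preg) ∧
        ∃ τ : ℤ, (τ = 1 ∨ τ = -1) ∧ ∀ y : Site 2, y ax - v ax = σ * ℓ → 0 ≤ τ * (y (oth ax) - v (oth ax)) →
          |y (oth ax) - v (oth ax)| ≤ Wr ℓ → y ∈ Pcore)
    {Ω Dg T : Finset V} (hPΩ : Win G φ w₀ Preg R ⊆ Ω) (hPD : Win G φ w₀ Preg R ⊆ Dg) (hPT : Win G φ w₀ Pcore R ⊆ T)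
    {Wt : Sym2 V → unitInterval} (hWD : IsSubbox (winGraphIn G Ω) Wt q Dg)
    -- far plain contacts: the inner neighbour lies in the target; non-plain contacts: the inner `Ω`-neighbour lies in the target
    (hfarT : ∀ x ∈ outerBoundary (winGraph G w₀ R) (winLevel G φ w₀ R lo hi j),
      inNbr G φ w₀ R (Finset.Icc (lo - (j : Site 2)) (hi + (j : Site 2))) x ∉ graphBall G w₀ (R - r₀) →
      inNbr G φ w₀ R (Finset.Icc (lo - (j : Site 2)) (hi + (j : Site 2))) x ∈ T)
    (hpadT : ∀ x ∈ outerBoundary (winGraphIn G Ω) (winLevelIn φ Ω lo hi j),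
      x ∉ outerBoundary (winGraph G w₀ R) (winLevel G φ w₀ R lo hi j) →
      inNbrIn G φ Ω (Finset.Icc (lo - (j : Site 2)) (hi + (j : Site 2))) x ∈ T) (R' : ℕ) :
    ∀ x ∈ outerBoundary (winGraphIn G Ω) (winLevelIn φ Ω lo hi j),
      (∃ u ∈ (habPad G φ Ω w₀ R lo hi j (slabGeomDeep G φ w₀ R lo hi j ℓs M R' r₀ (rectU hstep w₀ R lo hi j ℓs M A Rk))).U x, u ∈ T) ∨
      (x ∈ outerBoundary (winGraph G w₀ R) (winLevel G φ w₀ R lo hi j) ∧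
        inNbr G φ w₀ R (Finset.Icc (lo - (j : Site 2)) (hi + (j : Site 2))) x ∈ graphBall G w₀ (R - r₀) ∧
        1 - δ₂ < (bondPercolation G q).real (UniqZone.zone G
          (D.Λ (rectCtr hstep (deepCtr G φ w₀ R (lo - (j : Site 2)) (hi + (j : Site 2)) ℓs M x)
            (exitDir G φ w₀ R (lo - (j : Site 2)) (hi + (j : Site 2)) x).1 (exitDir G φ w₀ R (lo - (j : Site 2)) (hi + (j : Site 2)) x).2 ℓs
            (A (exitDir G φ w₀ R (lo - (j : Site 2)) (hi + (j : Site 2)) x).1))) D.k Mz) ∧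
        1 - δ₂ < (bondPercolation G q).real (linkIn
          (rectPrism G φ (rectCtr hstep (deepCtr G φ w₀ R (lo - (j : Site 2)) (hi + (j : Site 2)) ℓs M x)
            (exitDir G φ w₀ R (lo - (j : Site 2)) (hi + (j : Site 2)) x).1 (exitDir G φ w₀ R (lo - (j : Site 2)) (hi + (j : Site 2)) x).2 ℓs
            (A (exitDir G φ w₀ R (lo - (j : Site 2)) (hi + (j : Site 2)) x).1))
            (A (exitDir G φ w₀ R (lo - (j : Site 2)) (hi + (j : Site 2)) x).1) (Rk (exitDir G φ w₀ R (lo - (j : Site 2)) (hi + (j : Site 2)) x).1))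
          (D.Λ (rectCtr hstep (deepCtr G φ w₀ R (lo - (j : Site 2)) (hi + (j : Site 2)) ℓs M x)
            (exitDir G φ w₀ R (lo - (j : Site 2)) (hi + (j : Site 2)) x).1 (exitDir G φ w₀ R (lo - (j : Site 2)) (hi + (j : Site 2)) x).2 ℓs
            (A (exitDir G φ w₀ R (lo - (j : Site 2)) (hi + (j : Site 2)) x).1)) D.k)
          (rectU hstep w₀ R lo hi j ℓs M A Rk x)) ∧
        ∃ Qt Ft : Finset V, Ft ⊆ T ∧ Qt ⊆ Dg ∧
          Disjoint Ft (D.Λ (rectCtr hstep (deepCtr G φ w₀ R (lo - (j : Site 2)) (hi + (j : Site 2)) ℓs M x)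
            (exitDir G φ w₀ R (lo - (j : Site 2)) (hi + (j : Site 2)) x).1 (exitDir G φ w₀ R (lo - (j : Site 2)) (hi + (j : Site 2)) x).2 ℓs
            (A (exitDir G φ w₀ R (lo - (j : Site 2)) (hi + (j : Site 2)) x).1)) Mz) ∧
          1 - δ₂ < (prodBernoulli Wt).real (linkIn (↑Qt)
            (D.Λ (rectCtr hstep (deepCtr G φ w₀ R (lo - (j : Site 2)) (hi + (j : Site 2)) ℓs M x)
              (exitDir G φ w₀ R (lo - (j : Site 2)) (hi + (j : Site 2)) x).1 (exitDir G φ w₀ R (lo - (j : Site 2)) (hi + (j : Site 2)) x).2 ℓs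
              (A (exitDir G φ w₀ R (lo - (j : Site 2)) (hi + (j : Site 2)) x).1)) D.k) Ft)) := by
  intro x hx
  by_cases hp : x ∈ outerBoundary (winGraph G w₀ R) (winLevel G φ w₀ R lo hi j)
  swap
  · refine Or.inl ⟨inNbrIn G φ Ω (Finset.Icc (lo - (j : Site 2)) (hi + (j : Site 2))) x, ?_, hpadT x hx hp⟩
    rw [(habPad_of_not_mem hp).2.2]; exact Finset.mem_singleton_self _
  rw [(habPad_of_mem (κ := slabGeomDeep G φ w₀ R lo hi j ℓs M R' r₀ (rectU hstep w₀ R lo hi j ℓs M A Rk)) hp).2.2]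
  by_cases hnear : inNbr G φ w₀ R (Finset.Icc (lo - (j : Site 2)) (hi + (j : Site 2))) x ∈ graphBall G w₀ (R - r₀)
  · exact Or.inr ⟨hp, hnear, routeDatumT hlip hstep hfr hC hD h hMz hℓK0 hℓK1 hAw hRk hwide hA hK hr₀ hR Dr ax hMℓ hctr
      hdepth hWr hroom (winGraphIn_le G Ω) hPD hPT (Skel.adj_winGraphIn_of_subset hPΩ) hWD hp hnear⟩
  · refine Or.inl ⟨inNbr G φ w₀ R (Finset.Icc (lo - (j : Site 2)) (hi + (j : Site 2))) x, ?_, hfarT x hp hnear⟩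
    simp [slabGeomDeep, hnear]

end Datum

end Skelφ

end Summit.CriticalPhenomena.PercolationContinuityZ3.Theorems.Transplant

end
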